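import Literature.MathematicalPhysics.QuantumFieldTheory.Balaban1983to89.B4Ineq19ZeroBoxFace

/-!
# `Balaban1983to89.B4Thm19ZeroBoxNegAlpha` — B4 THEOREM p. 573: THE LITERAL HÖLDER RANGE «α < 1» OF THE TYPED
# LEAF `B4.ThmPrinted` FAILS AT ZERO FIELD ON CUBES — A KERNEL REFUTATION FOR EVERY `α < 0` (node 12's
# OBSERVATION (O-α) certified), AND THE HÖLDER-RANGE DICHOTOMY «`0 ≤ α < 1` HOLDS ∧ `α < 1` VERBATIM FAILS» ON THE
# ZERO-FIELD BOX FAMILIES (b04's verbatim carrier, node 12's bond-convention carrier, b04's default carrier)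

**Source.** T. Bałaban, *Regularity and Decay of Lattice Green's Functions*, Commun. Math. Phys. **89**, 571–597
(1983) (bib key `Balaban1983RegularityDecay`, «B4»): p. 573 [PDF 3] the Theorem («Proposition 2.1 of [1]») with
(1.9); p. 577 [PDF 7] the Hölder norms (2.14) and Lemma 2.2.  Quoted from the page renders
`b2b-balaban-ref1/pages/1983-cmp89-regularity-decay/1983-cmp89-regularity-decay-p003-x2.png` and `…-p007-x2.png`
(not from the OCR text); the print's `≦` is written `≤`.

## WHAT IS PRINTED (verbatim from the renders)

p. 573, Theorem (Proposition 2.1 of [1]): «For α < 1 there exist positive constants δ₀, c₀, R₀ independent of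
A, k, Ω and depending on d, M only, c₀ on α also, such that for e sufficiently small and for an arbitrary function
f : Ω → R^N, we have (1/|x − x′|^α)|U(A(Γ_{x,x′}))(D^η_{A,μ}G_k(Ω,A)f)(x′) − (D^η_{A,μ}G_k(Ω,A)f)(x)|
≤ c₀ exp(−δ₀ dist({x, x′}, supp f))‖f‖_∞ (1.9) for x, x′ ∈ Ω, and satisfying the condition
dist({x, x′}, Ω^c) ≥ R₀.» … «For some simple sets Ω, e.g. for rectangular parallelepipeds, the inequalities hold
without any restrictions on the points x, x′, i.e. for all x, x′ ∈ Ω.»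

p. 577: «We will need Hölder norms: ‖f‖_{1,α} = max{sup_x |f(x)|, sup_{x,μ} |(D^η_{A,μ}f)(x)|, sup_{x,x′,μ}
(1/|x′ − x|^α)|U(A(Γ_{x,x′}))·(D^η_{A,μ}f)(x′) − (D^η_{A,μ}f)(x)|}» (2.14); Lemma 2.2: «Then for e sufficiently
small and α < 1, there exists a constant c₁ depending on d, α only, such that ‖G_k(□,Ã)f‖_{1,α} ≤ c₁‖f‖_∞» (2.16).

The cell's typed leaf (b04, `B4.ThmPrinted fam`, untouched) transcribes the first sentence LITERALLY:
`∀ α : ℝ, α < 1 → ∃ δ₀ c₀ R₀ e₁ > 0, ∀ i, regular → bigBlocks → 0 < e ≤ e₁ → Ineq19_110 ∧ Ineq111_112` — with NO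
lower bound on `α`.

## WHAT IS CERTIFIED (HONEST SCOPE)

THE CASE `A = 0` (so `U ≡ 1`, `D^η_{0,μ} = B4Cor23Zero.fdiff`), `Ω = Ω₀` a CUBE of big blocks, mass `0`, for the
operator `G_k(Ω,0) = (−Δ^{η,N}_Ω + aP_k)^{-1}` of (1.6) (b04's `ZeroFieldInstance.green a = (fineOpR n a m² R)⁻¹`,
`B4Cor23ZeroEta`), read on node 12's ZERO-FIELD BOX FAMILY `BoxInst d ℓ m²₊` (`B4Ineq19ZeroBoxEta`; mesh
`η = L^{-k}`, `L = ℓ + 1 ≥ 2`, fine side `n = L^k`) through b04's verbatim carrier `boxFamB` (node 14), node 12's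
bond-convention carrier `boxFam`, and b04's default carrier `zeroFieldSetting` — b04's files are untouched.

* THE COUNTEREXAMPLE TO (1.9) FOR `α < 0` (all kernel facts; §2–§3).  Member `bigCube`: scale `k ≥ 1`, the cube
  `Ω = Ω₀ = [0, Mb·N)^{d+1}` of unit blocks (`N^{d+1}` big blocks of side `Mb`), mass `0`, any charge `e`; it meets
  EVERY typed antecedent — `regular` (void at `A = 0`), `bigBlocks`, `rect`, `e = e₁` (`bigCube_hypotheses`,
  `bigCube_rect`).  Test data (fine integer coordinates, `T := Mb·N`): `φ := 1_{y_μ = n − 1}` (`hyp`: the last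
  `η`-layer of the first row of unit blocks), SOURCE `f := (−Δ^{η,N}_Ω + aP_k)φ` (`src`).  Then `G_k(Ω,0)f = φ`
  EXACTLY (`green_mulVec_fineOpR_mulVec` ← `B4Lower18.fineOpR_inv_mul`: the Green's function is a genuine inverse,
  so NO lower bound on `G_k` is needed — this is how the obstacle recorded in node 12's (O-α), «a kernel refutation
  would need a uniform LOWER bound on |D_μG_k(Ω,0)f(x)|», is bypassed: the source is taken in the range of the
  operator); hence `(D_μG f)(x) = −η^{-1}·1 = −n` at `x = (n − 1)e_μ` (a genuine bond crossing into the second unit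
  block, `fdiff_hyp_near`) and `(D_μG f)(x′) = 0` at `x′ = (nT − 2)e_μ` (a genuine bond inside the last unit block,
  `fdiff_hyp_far`), `|x − x′|_η = (nT − 1 − n)/n ≥ T − 2` (`edistR_near_far_ge`), while
  `‖f‖_∞ ≤ 4(d+1)n² + a` (row sums of the operator, §1: `sum_abs_neumannLapR_le`, `sum_abs_diagK`,
  `sum_abs_avgK_boxDom`, `abs_fineOpR_mulVec_le`) and `exp(−δ₀·dist_η({x,x′}, supp f)) ≤ 1` for `δ₀ ≥ 0`.  So the
  left side of (1.9) is `≥ (T − 2)^{−α}·n` (`core_lhs_ge`) and the right side `≤ |c₀|(4(d+1)n² + a)` (`core_src_le`,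
  `rhs_le_abs`); with `N := negN d n a c₀ α = ⌈(|c₀|(4(d+1)n² + a)/n + 1)^{1/(−α)}⌉ + 3` big blocks per side the
  typed `Ineq19_110` FAILS (`negN_spec`, `ineq19B_fails`; in the bond-convention carrier both points carry genuine
  bonds, where the two Hölder fields agree, `ineq19Bond_fails` ← node 12's `bond_lhs19_eq_of_bond`).
* THE REFUTATIONS (§4).  For EVERY `α < 0` the `α`-clause of the typed leaf has NO constants at all: for every
  `δ₀ ≥ 0`, `c₀`, `R₀`, `e₁` there is a member with `e = e₁` (scale `k = 1`) meeting the antecedents and violating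
  `Ineq19_110` (`exists_member_violating_B`, `…_bond`; `leafClause_fails_B`, `…_bond`).  Hence, for every `L ≥ 2`,
  `a > 0`, `m²₊ ≥ 0`, `Mb ≥ 1` and boundary assignment `g`: `¬ ThmPrinted (boxFamB ℓ m²₊ a Mb g)`,
  `¬ ThmPrinted (boxFam ℓ m²₊ a Mb g)`, `¬ ThmPrinted (fun i ↦ zeroFieldSetting a Mb i.toZF)`; and over b04's OWN
  index type `ZeroFieldInstance d` (the refuting member is the image `i.toZF`, `L = 2`, `k = 1`, `m² = 0`):
  `¬ ThmPrinted (zeroFieldSettingB a Mb g)`, `¬ ThmPrinted (zeroFieldSetting a Mb)`,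
  `¬ ThmPrinted (zeroFieldSettingBond a Mb g)` for every `a > 0`, `Mb ≥ 1` (`not_thmPrinted_*`).
* THE HÖLDER-RANGE DICHOTOMY (§4, with nodes 12 and 14): on each box family the `0 ≤ α < 1` half
  `ThmPrinted19NN` HOLDS (node 14 `thmPrinted19NN_boxFamB`, `thmPrinted19NN_zeroFieldSetting`; node 12
  `thmPrinted19NN_boxFam`) AND the literal leaf FAILS (`holderRange_dichotomy_B`, `…_bond`, `…_std`); in
  particular the converse of node 12's `thmPrinted19NN_of_thmPrinted` is false (`not_thmPrinted_of_thmPrinted19NN`).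
  Non-vacuity at `d + 1 = 4`, `L = 2`, `a = 1`, `Mb = 1` (§5).
* THE READING (for b04 / the carver; analysis-level commentary, the kernel facts are the items above).  This is a
  statement about the TYPED TRANSCRIPTION, not against the paper: the print's «For α < 1» (Theorem p. 573; Lemma
  2.2 p. 577) names the exponent of the HÖLDER norm (2.14), whose range is `0 ≤ α < 1`; for `α < 0` the weight
  `|x − x′|^{−α} = |x − x′|^{|α|}` GROWS with the separation and (1.9) is no regularity statement — read literally it
  fails already for the free lattice Green's function on a cube in every dimension, as certified here.  The typed
  leaf `B4.ThmPrinted` (hence `LeafB4` through b04's `DagBinding`: `LeafB4 ↔ ThmPrinted famE ∧ …`) carries the literal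
  binder `∀ α, α < 1 →`; consequently NO faithful zero-field carrier containing cubes of unbounded size discharges it.
  The natural repair — NOT made here — is the binder pair `0 ≤ α → α < 1 →` (node 12's `ThmPrinted19NN` shape),
  under which nodes 12/14 discharge the (1.9)–(1.10) half on boxes.

NOT certified / not claimed: anything at `A ≠ 0`; anything for `0 ≤ α < 1` beyond the cited nodes; the conjuncts
(1.10)–(1.12) play no role (the violated clause is (1.9) alone, on a cube, where `Ω = Ω₀`); regions other than
cubes; the positivity of `c₀, R₀, e₁` is not used, and `δ₀` enters only through `exp(−δ₀·dist) ≤ 1` (`δ₀ ≥ 0`).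
The constants of the violated instance depend on the family parameters `L, a` as everywhere in this lineage.

DICTIONARY (print ↦ Lean, all from b04 / nodes 12, 14): `Ω = Ω₀` ↦ `boxDom (fun _ ↦ L^k·(Mb·N))` (`bigCube`,
`BoxInst.toZF`); `G_k(Ω,0)` ↦ `(fineOpR n a 0 R)⁻¹`; `D^η_{0,μ}` ↦ `fdiff n R μ`; `|x − x′|` ↦ `edistR n R`
(`η`-scaled sup-distance); `‖f‖_∞` ↦ `ZeroFieldInstance.supN`; `dist({x,x′}, supp f)` ↦ `sdist2 = setDist (edistR …)
({x} ∪ {x′}) (supp f)`; `U(A(Γ)) ↦ 1`; (1.9)–(1.10) ↦ `B4.Ineq19_110`; the Theorem ↦ `B4.ThmPrinted`.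

DEPENDENCIES (kernel-proved tree modules only; no Literature fact is minted, no hypothesis is assumed): node 14
`B4Ineq19ZeroBoxFace` (`thmPrinted19NN_boxFamB`, `thmPrinted19NN_zeroFieldSetting`; → node 12 `B4Ineq19ZeroBoxEta`:
`BoxInst`, `toZF`, `boxFam`, `boxFamB`, `BoxInst.rect`, `bond_lhs19_eq_of_bond`, `supN_nonneg`,
`setDist_edistR_nonneg`, `ThmPrinted19NN`, `thmPrinted19NN_boxFam`), b04's `B4` (`ThmPrinted`, `Ineq19_110`,
`Ineq111_112`), `B4Cor23ZeroEta` (`ZeroFieldInstance`, `zeroFieldSettingB`, `zeroFieldSetting`), `B4Lower18`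
(`fineOpR`, `fineOpR_inv_mul`, `boxDom_isBlockUnion`, `neumannLapR`, `edistR`), `B4Reflection242` (`boxDom`, `nbrs`,
`card_nbrs`, `diagK`, `avgK`, `blk_mem_boxDom`), `B4BoxCov237` (`uvec`, `card_filter_blk`), `B4ContourShift`
(`supNorm`), `B4Cor23Zero` (`fdiff`, `supp`), `B4Cor23ZeroDelta` (`setDist`); Mathlib otherwise.

VERSIONS: v1 (this file).

Value = kernel certificate of a TYPING DEFECT of the cell's leaf `B4.ThmPrinted` (the literal Hölder range), with an
explicit zero-field counterexample, and the matching dichotomy with nodes 12/14; negative knowledge for b04 / the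
carver; NOT summit progress and NOT a claim against B4's Theorem.
-/

namespace Literature.MathematicalPhysics.QuantumFieldTheory.Balaban1983to89.B4Thm19ZeroBoxNegAlpha

open Finset Matrix
open Literature.MathematicalPhysics.QuantumFieldTheory.Balaban1983to89.B4 (EtaSetting Ineq19_110 Ineq111_112
  ThmPrinted)
open Literature.MathematicalPhysics.QuantumFieldTheory.Balaban1983to89.B4ContourShift (supNorm supNorm_nonneg
  abs_le_supNorm)
open Literature.MathematicalPhysics.QuantumFieldTheory.Balaban1983to89.B4Reflection242 (boxDom mem_boxDom blk diagK
  avgK nbrs card_nbrs blk_mem_boxDom)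
open Literature.MathematicalPhysics.QuantumFieldTheory.Balaban1983to89.B4BoxCov237 (uvec card_filter_blk)
open Literature.MathematicalPhysics.QuantumFieldTheory.Balaban1983to89.B4Lower18 (fineOpR regionOpR neumannLapR
  edistR IsBlockUnion boxDom_isBlockUnion fineOpR_inv_mul)
open Literature.MathematicalPhysics.QuantumFieldTheory.Balaban1983to89.B4Cor23Zero (fdiff fdiff_of_mem supp)
open Literature.MathematicalPhysics.QuantumFieldTheory.Balaban1983to89.B4Cor23ZeroDelta (setDist)
open Literature.MathematicalPhysics.QuantumFieldTheory.Balaban1983to89.B4Cor23ZeroEta (ZeroFieldInstance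
  zeroFieldSettingB zeroFieldSetting)
open Literature.MathematicalPhysics.QuantumFieldTheory.Balaban1983to89.B4Ineq19ZeroBoxEta (BoxInst boxFam boxFamB
  zeroFieldSettingBond abs_le_supN supN_nonneg setDist_edistR_nonneg bond_lhs19_eq_of_bond ThmPrinted19NN
  thmPrinted19NN_boxFam)
open Literature.MathematicalPhysics.QuantumFieldTheory.Balaban1983to89.B4Ineq19ZeroBoxFace (thmPrinted19NN_boxFamB
  thmPrinted19NN_zeroFieldSetting)

variable {d : ℕ}

/-! ## §1 The row-sum bound of the operator (1.6) at `A = 0`: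
`‖(−Δ^{η,N} + m² + aP_k)φ‖_∞ ≤ (4(d+1)n² + m² + a)‖φ‖_∞` -/

section RowSum

/-- `Σ_y |Δ^N-kernel(x, y)| ≤ 4(d+1)` on any finite region. [folklore] -/
theorem sum_abs_neumannLapR_le (R : Finset (Fin (d + 1) → ℤ)) (x : ↥R) :
    ∑ y : ↥R, |neumannLapR R x.1 y.1| ≤ 4 * ((d : ℝ) + 1) := by
  have hpt : ∀ y : ↥R, |neumannLapR R x.1 y.1| ≤
      (if y = x then 2 * ((d : ℝ) + 1) else 0) + (if y.1 ∈ nbrs x.1 then 1 else 0) := by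
    intro y
    by_cases hy : y = x
    · subst hy
      have h1 : (((nbrs y.1).filter fun z => z ∈ R).card : ℝ) ≤ 2 * ((d : ℝ) + 1) := by
        have := (Finset.card_filter_le (nbrs y.1) (fun z => z ∈ R)).trans (card_nbrs y.1).le
        exact_mod_cast this
      simp only [neumannLapR, if_true, Nat.abs_cast]
      have h2 : (0 : ℝ) ≤ if y.1 ∈ nbrs y.1 then 1 else 0 := by split_ifs <;> norm_num
      linarith
    · have hy1 : y.1 ≠ x.1 := fun h => hy (Subtype.ext h)
      simp only [neumannLapR, hy1, if_false, hy]
      split_ifs <;> simp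
  refine (Finset.sum_le_sum fun y _ => hpt y).trans ?_
  rw [Finset.sum_add_distrib, Finset.sum_ite_eq' Finset.univ x, if_pos (Finset.mem_univ _)]
  have h3 : ∑ y : ↥R, (if y.1 ∈ nbrs x.1 then (1 : ℝ) else 0) ≤ 2 * ((d : ℝ) + 1) := by
    rw [Finset.sum_boole]
    have h4 : (Finset.univ.filter fun y : ↥R => y.1 ∈ nbrs x.1).card ≤ (nbrs x.1).card := by
      refine Finset.card_le_card_of_injOn (fun y : ↥R => y.1) (fun y hy => ?_) (fun y _ z _ h => Subtype.ext h)
      have hy' : y ∈ Finset.univ.filter fun y : ↥R => y.1 ∈ nbrs x.1 := hy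
      simpa using (Finset.mem_filter.1 hy').2
    have h5 := h4.trans (card_nbrs x.1).le
    exact_mod_cast h5
  linarith

/-- `Σ_y |m²·1_{y = x}| = |m²|`. [folklore] -/
theorem sum_abs_diagK (R : Finset (Fin (d + 1) → ℤ)) (c : ℝ) (x : ↥R) :
    ∑ y : ↥R, |diagK c x.1 y.1| = |c| := by
  have : ∀ y : ↥R, |diagK c x.1 y.1| = if y = x then |c| else 0 := by
    intro y
    by_cases hy : y = x
    · subst hy; simp [diagK]
    · have hy1 : y.1 ≠ x.1 := fun h => hy (Subtype.ext h)
      simp [diagK, hy1, hy]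
  rw [Finset.sum_congr rfl fun y _ => this y, Finset.sum_ite_eq' Finset.univ x, if_pos (Finset.mem_univ _)]

/-- on the fine box `Π[0, nM_μ)` the block-averaging kernel has row sum `Σ_y |c·1_{blk y = blk x}| = |c|·n^{d+1}`.
[folklore] -/
theorem sum_abs_avgK_boxDom {n : ℕ} (hn : 1 ≤ n) (M : Fin (d + 1) → ℕ) (c : ℝ)
    (x : ↥(boxDom (fun i => n * M i))) :
    ∑ y : ↥(boxDom (fun i => n * M i)), |avgK c n x.1 y.1| = |c| * (n : ℝ) ^ (d + 1) := by
  have hb : blk n x.1 ∈ boxDom M := blk_mem_boxDom hn x.2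
  have e1 : ∀ y : ↥(boxDom (fun i => n * M i)), |avgK c n x.1 y.1| = if blk n y.1 = blk n x.1 then |c| else 0 := by
    intro y; unfold avgK; split_ifs <;> simp
  rw [Finset.sum_congr rfl fun y _ => e1 y, Finset.sum_ite, Finset.sum_const_zero, add_zero, Finset.sum_const,
    nsmul_eq_mul]
  have hc := card_filter_blk hn M ⟨blk n x.1, hb⟩
  simp only at hc
  rw [hc]; push_cast; ring

/-- **ROW-SUM BOUND**: on the fine box, `|((−Δ^{η,N} + m² + aP_k)φ)(x)| ≤ (4(d+1)n² + |m²| + |a|)·B` whenever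
`|φ| ≤ B`. [folklore] -/
theorem abs_fineOpR_mulVec_le {n : ℕ} (hn : 1 ≤ n) (M : Fin (d + 1) → ℕ) (a m2 : ℝ)
    (φ : ↥(boxDom (fun i => n * M i)) → ℝ) {B : ℝ} (hB : ∀ y, |φ y| ≤ B)
    (x : ↥(boxDom (fun i => n * M i))) :
    |(fineOpR n a m2 (boxDom (fun i => n * M i)) *ᵥ φ) x| ≤
      (4 * ((d : ℝ) + 1) * (n : ℝ) ^ 2 + |m2| + |a|) * B := by
  have hB0 : 0 ≤ B := (abs_nonneg _).trans (hB x)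
  have e1 : (fineOpR n a m2 (boxDom (fun i => n * M i)) *ᵥ φ) x =
      ∑ y, fineOpR n a m2 (boxDom (fun i => n * M i)) x y * φ y := rfl
  rw [e1]
  have h1 : |∑ y, fineOpR n a m2 (boxDom (fun i => n * M i)) x y * φ y| ≤
      ∑ y, |fineOpR n a m2 (boxDom (fun i => n * M i)) x y| * B := by
    refine (Finset.abs_sum_le_sum_abs _ _).trans (Finset.sum_le_sum fun y _ => ?_)
    rw [abs_mul]
    exact mul_le_mul_of_nonneg_left (hB y) (abs_nonneg _)
  refine h1.trans ?_
  rw [← Finset.sum_mul]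
  refine mul_le_mul_of_nonneg_right ?_ hB0
  have e2 : ∀ y, fineOpR n a m2 (boxDom (fun i => n * M i)) x y =
      (n : ℝ) ^ 2 * neumannLapR (boxDom (fun i => n * M i)) x.1 y.1 +
        (diagK m2 x.1 y.1 + avgK (a * ((n : ℝ) ^ (d + 1))⁻¹) n x.1 y.1) :=
    fun y => rfl
  have h2 : ∀ y, |fineOpR n a m2 (boxDom (fun i => n * M i)) x y| ≤
      (n : ℝ) ^ 2 * |neumannLapR (boxDom (fun i => n * M i)) x.1 y.1| +
        (|diagK m2 x.1 y.1| + |avgK (a * ((n : ℝ) ^ (d + 1))⁻¹) n x.1 y.1|) := by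
    intro y
    rw [e2]
    refine (abs_add_le _ _).trans (add_le_add ?_ (abs_add_le _ _))
    rw [abs_mul, abs_of_nonneg (by positivity : (0 : ℝ) ≤ (n : ℝ) ^ 2)]
  refine (Finset.sum_le_sum fun y _ => h2 y).trans ?_
  rw [Finset.sum_add_distrib, Finset.sum_add_distrib, ← Finset.mul_sum, sum_abs_diagK,
    sum_abs_avgK_boxDom hn M]
  have h3 := sum_abs_neumannLapR_le (boxDom (fun i => n * M i)) x
  have h4 : |a * ((n : ℝ) ^ (d + 1))⁻¹| * (n : ℝ) ^ (d + 1) = |a| := by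
    rw [abs_mul, abs_inv, abs_of_pos (by positivity : (0 : ℝ) < (n : ℝ) ^ (d + 1))]
    field_simp
  rw [h4]
  nlinarith [h3, sq_nonneg (n : ℝ)]

end RowSum

/-- `‖f‖_∞ ≤ C` from a pointwise bound. [folklore] -/
theorem supN_le_of_forall_le {i : ZeroFieldInstance d} (f : ↥i.R → ℝ) {C : ℝ} (hC : 0 ≤ C)
    (h : ∀ x, |f x| ≤ C) : i.supN f ≤ C := by
  unfold ZeroFieldInstance.supN
  split_ifs with hne
  · exact Finset.sup'_le _ _ fun y _ => h y
  · exact hC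

/-! ## §2 The witness: the hyperplane indicator `φ = 1_{y_μ = n − 1}`, a block-boundary bond and a far bond -/

section Hyperplane

variable {n T : ℕ}

/-- the point `t·e_μ` lies in the fine cube `[0, nT)^{d+1}` for `0 ≤ t < nT`. [folklore] -/
theorem single_mem_boxDom (μ : Fin (d + 1)) {t : ℤ} (h0 : 0 ≤ t) (ht : t < (n : ℤ) * T) :
    (Pi.single μ t : Fin (d + 1) → ℤ) ∈ boxDom (fun _ : Fin (d + 1) => n * T) := by
  rw [mem_boxDom]
  intro j
  by_cases hj : j = μ
  · subst hj
    rw [Pi.single_eq_same]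
    push_cast
    exact ⟨h0, ht⟩
  · rw [Pi.single_eq_of_ne hj]
    refine ⟨le_rfl, ?_⟩
    push_cast
    exact lt_of_le_of_lt h0 ht

/-- `t·e_μ + e_μ = (t+1)·e_μ`. [folklore] -/
theorem single_add_uvec (μ : Fin (d + 1)) (t : ℤ) :
    (Pi.single μ t : Fin (d + 1) → ℤ) + uvec μ = Pi.single μ (t + 1) := by
  rw [uvec, ← Pi.single_add]

/-- THE TEST FUNCTION: the indicator of the hyperplane `{y : y_μ = n − 1}` (the last `μ`-layer of the first row of
unit blocks) on the fine cube `[0, nT)^{d+1}`. [folklore] -/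
noncomputable def hyp (n T : ℕ) (μ : Fin (d + 1)) (y : ↥(boxDom (fun _ : Fin (d + 1) => n * T))) : ℝ :=
  if y.1 μ = (n : ℤ) - 1 then 1 else 0

/-- `|φ| ≤ 1`. [folklore] -/
theorem abs_hyp_le (μ : Fin (d + 1)) (y : ↥(boxDom (fun _ : Fin (d + 1) => n * T))) : |hyp n T μ y| ≤ 1 := by
  unfold hyp; split_ifs <;> simp

/-- `φ(t·e_μ) = [t = n − 1]`. [folklore] -/
theorem hyp_single (μ : Fin (d + 1)) {t : ℤ}
    (h : (Pi.single μ t : Fin (d + 1) → ℤ) ∈ boxDom (fun _ : Fin (d + 1) => n * T)) :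
    hyp n T μ ⟨Pi.single μ t, h⟩ = if t = (n : ℤ) - 1 then 1 else 0 := by
  simp [hyp]

/-- `φ(t·e_μ + e_μ) = [t + 1 = n − 1]`. [folklore] -/
theorem hyp_single_fwd (μ : Fin (d + 1)) {t : ℤ}
    (h : (Pi.single μ t : Fin (d + 1) → ℤ) + uvec μ ∈ boxDom (fun _ : Fin (d + 1) => n * T)) :
    hyp n T μ ⟨Pi.single μ t + uvec μ, h⟩ = if t + 1 = (n : ℤ) - 1 then 1 else 0 := by
  have hm : (Pi.single μ (t + 1) : Fin (d + 1) → ℤ) ∈ boxDom (fun _ : Fin (d + 1) => n * T) := by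
    rw [← single_add_uvec]; exact h
  have e : (⟨(Pi.single μ t : Fin (d + 1) → ℤ) + uvec μ, h⟩ : ↥(boxDom (fun _ : Fin (d + 1) => n * T))) =
      ⟨Pi.single μ (t + 1), hm⟩ := Subtype.ext (single_add_uvec μ t)
  rw [e, hyp_single]

variable (hn : 2 ≤ n) (hT : 2 ≤ T)
include hn hT

omit hn in
/-- `2n ≤ nT` (as integers). [folklore] -/
theorem two_n_le : (2 : ℤ) * n ≤ (n : ℤ) * T := by
  have h : 2 * n ≤ n * T := by nlinarith
  exact_mod_cast h

/-- the near point `x = (n−1)·e_μ` lies in the cube. [folklore] -/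
theorem near_mem (μ : Fin (d + 1)) :
    (Pi.single μ ((n : ℤ) - 1) : Fin (d + 1) → ℤ) ∈ boxDom (fun _ : Fin (d + 1) => n * T) :=
  single_mem_boxDom μ (by omega) (by have := two_n_le (n := n) hT; linarith)

/-- its forward neighbour `n·e_μ` lies in the cube (a genuine bond, crossing into the second unit block). [folklore] -/
theorem near_fwd_mem (μ : Fin (d + 1)) :
    (Pi.single μ ((n : ℤ) - 1) : Fin (d + 1) → ℤ) + uvec μ ∈ boxDom (fun _ : Fin (d + 1) => n * T) := by
  rw [single_add_uvec, sub_add_cancel]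
  exact single_mem_boxDom μ (by omega) (by have := two_n_le (n := n) hT; nlinarith)

/-- the far point `x′ = (nT − 2)·e_μ` lies in the cube. [folklore] -/
theorem far_mem (μ : Fin (d + 1)) :
    (Pi.single μ ((n : ℤ) * T - 2) : Fin (d + 1) → ℤ) ∈ boxDom (fun _ : Fin (d + 1) => n * T) :=
  single_mem_boxDom μ (by have := two_n_le (n := n) hT; nlinarith) (by linarith)

/-- its forward neighbour `(nT − 1)·e_μ` lies in the cube (a genuine bond inside the last unit block). [folklore] -/
theorem far_fwd_mem (μ : Fin (d + 1)) :
    (Pi.single μ ((n : ℤ) * T - 2) : Fin (d + 1) → ℤ) + uvec μ ∈ boxDom (fun _ : Fin (d + 1) => n * T) := by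
  rw [single_add_uvec]
  exact single_mem_boxDom μ (by have := two_n_le (n := n) hT; nlinarith) (by linarith)

/-- `(∂^η_μ φ)(x) = −n` at the block-boundary bond: `φ(x) = 1`, `φ(x + ηe_μ) = 0`. [folklore] -/
theorem fdiff_hyp_near (μ : Fin (d + 1)) :
    fdiff n (boxDom (fun _ : Fin (d + 1) => n * T)) μ (hyp n T μ) ⟨_, near_mem hn hT μ⟩ = -(n : ℝ) := by
  rw [fdiff_of_mem _ (near_fwd_mem hn hT μ)]
  have e1 : hyp n T μ ⟨(Pi.single μ ((n : ℤ) - 1) : Fin (d + 1) → ℤ) + uvec μ, near_fwd_mem hn hT μ⟩ = 0 := by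
    rw [hyp_single_fwd, if_neg (by omega)]
  have e2 : hyp n T μ ⟨_, near_mem hn hT μ⟩ = 1 := by rw [hyp_single, if_pos rfl]
  rw [e1, e2]; ring

/-- `(∂^η_μ φ)(x′) = 0` at the far bond: `φ = 0` at both end-points. [folklore] -/
theorem fdiff_hyp_far (μ : Fin (d + 1)) :
    fdiff n (boxDom (fun _ : Fin (d + 1) => n * T)) μ (hyp n T μ) ⟨_, far_mem hn hT μ⟩ = 0 := by
  rw [fdiff_of_mem _ (far_fwd_mem hn hT μ)]
  have h2n := two_n_le (n := n) hT
  have hn' : (2 : ℤ) ≤ n := by exact_mod_cast hn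
  have e1 : hyp n T μ ⟨(Pi.single μ ((n : ℤ) * T - 2) : Fin (d + 1) → ℤ) + uvec μ, far_fwd_mem hn hT μ⟩ = 0 := by
    rw [hyp_single_fwd, if_neg (by nlinarith)]
  have e2 : hyp n T μ ⟨_, far_mem hn hT μ⟩ = 0 := by
    rw [hyp_single, if_neg (by nlinarith)]
  rw [e1, e2]; ring

/-- the two points are far apart: `|x − x′|_η ≥ T − 2` (`|x − x′|_η = (nT − 1 − n)/n`). [folklore] -/
theorem edistR_near_far_ge (μ : Fin (d + 1)) :
    (T : ℝ) - 2 ≤ edistR n (boxDom (fun _ : Fin (d + 1) => n * T)) ⟨_, near_mem hn hT μ⟩ ⟨_, far_mem hn hT μ⟩ := by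
  have key : ∀ x x' : ↥(boxDom (fun _ : Fin (d + 1) => n * T)), x.1 = Pi.single μ ((n : ℤ) - 1) →
      x'.1 = Pi.single μ ((n : ℤ) * T - 2) → (T : ℝ) - 2 ≤ edistR n (boxDom (fun _ : Fin (d + 1) => n * T)) x x' := by
    intro x x' hx hx'
    unfold edistR
    rw [hx, hx']
    have hnpos : (0 : ℝ) < n := by exact_mod_cast (by omega : 0 < n)
    have hn' : (2 : ℝ) ≤ n := by exact_mod_cast hn
    have h1 := abs_le_supNorm ((Pi.single μ ((n : ℤ) - 1) - Pi.single μ ((n : ℤ) * T - 2) : Fin (d + 1) → ℤ)) μ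
    have h2 : ((Pi.single μ ((n : ℤ) - 1) - Pi.single μ ((n : ℤ) * T - 2) : Fin (d + 1) → ℤ) μ)
        = ((n : ℤ) - 1) - ((n : ℤ) * T - 2) := by simp
    rw [h2] at h1
    have h2n := two_n_le (n := n) hT
    have h3 : ((|((n : ℤ) - 1) - ((n : ℤ) * T - 2)| : ℤ) : ℝ) = (n : ℝ) * T - 1 - n := by
      rw [abs_of_nonpos (by linarith)]
      push_cast; ring
    rw [h3] at h1
    rw [show (T : ℝ) - 2 = 1 / (n : ℝ) * ((n : ℝ) * T - 2 * n) by field_simp]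
    exact mul_le_mul_of_nonneg_left (by linarith) (by positivity)
  exact key _ _ rfl rfl

/-- `G_k(□)f = φ` for `f := (−Δ^{η,N} + m² + aP_k)φ` (the Green's function is a genuine inverse, `B4Lower18`).
[folklore] -/
theorem green_mulVec_fineOpR_mulVec {a : ℝ} (ha : 0 < a) {m2 : ℝ} (hm2 : 0 ≤ m2)
    (φ : ↥(boxDom (fun _ : Fin (d + 1) => n * T)) → ℝ) :
    (fineOpR n a m2 (boxDom (fun _ : Fin (d + 1) => n * T)))⁻¹ *ᵥ
        (fineOpR n a m2 (boxDom (fun _ : Fin (d + 1) => n * T)) *ᵥ φ) = φ := by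
  have h1n : 1 ≤ n := by omega
  have _hT1 : 1 ≤ T := by omega
  have hpos : 0 < min 2 a + m2 := by
    have : 0 < min 2 a := lt_min (by norm_num) ha
    linarith
  rw [Matrix.mulVec_mulVec, fineOpR_inv_mul h1n ha.le hpos (boxDom_isBlockUnion h1n fun _ => T),
    Matrix.one_mulVec]

omit hn hT in
/-- THE SOURCE `f := (−Δ^{η,N}_Ω + aP_k)φ` (mass `0`) on the fine cube `[0, nT)^{d+1}`. [folklore] -/
noncomputable def src (n T : ℕ) (a : ℝ) (μ : Fin (d + 1)) : ↥(boxDom (fun _ : Fin (d + 1) => n * T)) → ℝ :=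
  fineOpR n a 0 (boxDom (fun _ : Fin (d + 1) => n * T)) *ᵥ hyp n T μ

/-- **THE CORE ESTIMATE (left side)**: with `f := (−Δ^{η,N} + aP_k)φ` (mass `0`), `G_k(Ω)f = φ`, so the left-hand
side of (1.9) at the pair `(x, x′)` is `|x − x′|_η^{−α}·|∂_μφ(x′) − ∂_μφ(x)| = |x − x′|_η^{−α}·n ≥ (T − 2)^{−α}·n` for
`α ≤ 0`. [folklore] -/
theorem core_lhs_ge {a : ℝ} (ha : 0 < a) (μ : Fin (d + 1)) {α : ℝ} (hα : α ≤ 0) :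
    ((T : ℝ) - 2) ^ (-α) * (n : ℝ) ≤
      edistR n (boxDom (fun _ : Fin (d + 1) => n * T)) ⟨_, near_mem hn hT μ⟩ ⟨_, far_mem hn hT μ⟩ ^ (-α) *
        |fdiff n (boxDom (fun _ : Fin (d + 1) => n * T)) μ
              ((fineOpR n a 0 (boxDom (fun _ : Fin (d + 1) => n * T)))⁻¹ *ᵥ src n T a μ) ⟨_, far_mem hn hT μ⟩ -
          fdiff n (boxDom (fun _ : Fin (d + 1) => n * T)) μ
              ((fineOpR n a 0 (boxDom (fun _ : Fin (d + 1) => n * T)))⁻¹ *ᵥ src n T a μ) ⟨_, near_mem hn hT μ⟩| := by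
  unfold src
  rw [green_mulVec_fineOpR_mulVec hn hT ha le_rfl, fdiff_hyp_far hn hT μ, fdiff_hyp_near hn hT μ, sub_neg_eq_add,
    zero_add, Nat.abs_cast]
  refine mul_le_mul_of_nonneg_right ?_ (by positivity)
  have hT' : (2 : ℝ) ≤ T := by exact_mod_cast hT
  exact Real.rpow_le_rpow (by linarith) (edistR_near_far_ge hn hT μ) (by linarith)

/-- **THE CORE ESTIMATE (right side)**: `‖f‖_∞ ≤ 4(d+1)n² + a` pointwise (§1 with `|φ| ≤ 1`, `m² = 0`). [folklore] -/
theorem core_src_le {a : ℝ} (ha : 0 < a) (μ : Fin (d + 1)) (y : ↥(boxDom (fun _ : Fin (d + 1) => n * T))) :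
    |src n T a μ y| ≤ 4 * ((d : ℝ) + 1) * (n : ℝ) ^ 2 + a := by
  have hb := abs_fineOpR_mulVec_le (by omega : 1 ≤ n) (fun _ => T) a 0 (hyp n T μ) (fun z => abs_hyp_le μ z) y
  rw [abs_zero, add_zero, abs_of_pos ha, mul_one] at hb
  have _h := hT
  exact hb

end Hyperplane

/-! ## §3 The failing member of the box family and the violated instance of (1.9) for `α < 0` -/

section Member

variable {ℓ : ℕ} {m2plus : ℝ}

/-- **THE WITNESS MEMBER** of the zero-field box family (`B4Ineq19ZeroBoxEta.BoxInst`): scale `k` (mesh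
`η = L^{-k}`), the CUBE `Ω = [0, Mb·N)^{d+1}` of `N^{d+1}` big blocks (`(Mb·N)^{d+1}` unit blocks), `Ω₀ = Ω`, mass
`m² = 0`, charge `e`. [cite: Balaban1983RegularityDecay, §1 pp. 572–573, case A = 0, Ω a cube of big blocks] -/
noncomputable def bigCube (ℓ : ℕ) {m2plus : ℝ} (hm2 : 0 ≤ m2plus) (k : ℕ) (hk : 1 ≤ k) (Mb N : ℕ)
    (hMN : 1 ≤ Mb * N) (e : ℝ) : BoxInst d ℓ m2plus where
  k := k
  hk := hk
  M := fun _ => Mb * N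
  hM := fun _ => hMN
  R₀ := boxDom (fun _ : Fin (d + 1) => (ℓ + 1) ^ k * (Mb * N))
  hR₀ := boxDom_isBlockUnion (BoxInst.one_le_Lk ℓ k) (fun _ => Mb * N)
  hsub := Finset.Subset.refl _
  m2 := 0
  hm := le_rfl
  hm' := hm2
  e := e

/-- THE WITNESS MEETS EVERY TYPED ANTECEDENT of the leaf: `regular` (void at `A = 0`), `bigBlocks` (`Ω = Ω₀` is a
union of big blocks of side `Mb`), and its charge is the prescribed `e` (so `0 < e ≤ e₁` is met with `e := e₁`).
[folklore] -/
theorem bigCube_hypotheses (hm2 : 0 ≤ m2plus) (a : ℝ) (g : ∀ i : ZeroFieldInstance d, (↥i.R → ℝ) → ℝ)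
    (k : ℕ) (hk : 1 ≤ k) {Mb N : ℕ} (hMb : 1 ≤ Mb) (hMN : 1 ≤ Mb * N) (e : ℝ) :
    (boxFamB ℓ m2plus a Mb g (bigCube ℓ hm2 k hk Mb N hMN e)).regular ∧
      (boxFamB ℓ m2plus a Mb g (bigCube ℓ hm2 k hk Mb N hMN e)).bigBlocks ∧
      (boxFamB ℓ m2plus a Mb g (bigCube ℓ hm2 k hk Mb N hMN e)).e = e := by
  have hMn : 1 ≤ Mb * (ℓ + 1) ^ k := by simpa using Nat.mul_le_mul hMb (BoxInst.one_le_Lk ℓ k)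
  have h := boxDom_isBlockUnion (d := d) hMn fun _ => N
  have e1 : (fun _ : Fin (d + 1) => Mb * (ℓ + 1) ^ k * N) = fun _ : Fin (d + 1) => (ℓ + 1) ^ k * (Mb * N) := by
    funext; ring
  rw [e1] at h
  exact ⟨trivial, ⟨h, h⟩, rfl⟩

/-- the same three facts for the bond-convention family `boxFam` (identical fields). [folklore] -/
theorem bigCube_hypotheses_bond (hm2 : 0 ≤ m2plus) (a : ℝ) (g : ∀ i : ZeroFieldInstance d, (↥i.R → ℝ) → ℝ)
    (k : ℕ) (hk : 1 ≤ k) {Mb N : ℕ} (hMb : 1 ≤ Mb) (hMN : 1 ≤ Mb * N) (e : ℝ) :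
    (boxFam ℓ m2plus a Mb g (bigCube ℓ hm2 k hk Mb N hMN e)).regular ∧
      (boxFam ℓ m2plus a Mb g (bigCube ℓ hm2 k hk Mb N hMN e)).bigBlocks ∧
      (boxFam ℓ m2plus a Mb g (bigCube ℓ hm2 k hk Mb N hMN e)).e = e :=
  bigCube_hypotheses hm2 a g k hk hMb hMN e

/-- the witness box is a rectangular parallelepiped, so the typed antecedent `rect ∨ …` of (1.9) is met for EVERY
pair of points (b04's carrier; node 12's `BoxInst.rect` is the same proposition). [folklore] -/
theorem bigCube_rect (hm2 : 0 ≤ m2plus) (a : ℝ) (g : ∀ i : ZeroFieldInstance d, (↥i.R → ℝ) → ℝ)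
    (k : ℕ) (hk : 1 ≤ k) (Mb N : ℕ) (hMN : 1 ≤ Mb * N) (e : ℝ) :
    (boxFamB ℓ m2plus a Mb g (bigCube ℓ hm2 k hk Mb N hMN e)).rect :=
  BoxInst.rect a Mb g (bigCube ℓ hm2 k hk Mb N hMN e)

/-- `L^k ≥ 2` for `L ≥ 2`, `k ≥ 1`. [folklore] -/
theorem two_le_Lk (hℓ : 1 ≤ ℓ) {k : ℕ} (hk : 1 ≤ k) : 2 ≤ (ℓ + 1) ^ k :=
  le_trans (by omega) (Nat.le_self_pow (by omega) (ℓ + 1))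

/-- `Mb·N ≥ 2` for `Mb ≥ 1`, `N ≥ 2`. [folklore] -/
theorem two_le_MbN {Mb N : ℕ} (hMb : 1 ≤ Mb) (hN : 2 ≤ N) : 2 ≤ Mb * N :=
  le_trans hN (Nat.le_mul_of_pos_left N hMb)

/-- the real-number tail of the argument: `c₀e^{−δ₀s}S ≤ |c₀|F` for `δ₀, s ≥ 0`, `0 ≤ S ≤ F`. [folklore] -/
theorem rhs_le_abs {c₀ δ₀ s S F : ℝ} (hδ : 0 ≤ δ₀) (hs : 0 ≤ s) (hS0 : 0 ≤ S) (hSF : S ≤ F) :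
    c₀ * Real.exp (-(δ₀ * s)) * S ≤ |c₀| * F := by
  have he1 : Real.exp (-(δ₀ * s)) ≤ 1 := Real.exp_le_one_iff.2 (by nlinarith)
  have he0 : 0 ≤ Real.exp (-(δ₀ * s)) := (Real.exp_pos _).le
  calc c₀ * Real.exp (-(δ₀ * s)) * S ≤ |c₀| * Real.exp (-(δ₀ * s)) * S :=
        mul_le_mul_of_nonneg_right (mul_le_mul_of_nonneg_right (le_abs_self c₀) he0) hS0
    _ ≤ |c₀| * 1 * F := mul_le_mul (mul_le_mul_of_nonneg_left he1 (abs_nonneg _)) hSF hS0 (by positivity)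
    _ = |c₀| * F := by ring

/-- **(1.9) FAILS FOR `α < 0` IN b04's VERBATIM CARRIER.**  For the witness member (scale `k`, cube of `N ≥ 2` big
blocks per side, `n = L^k`, `T = Mb·N`) and ANY `δ₀ ≥ 0`, `R₀`: if `|c₀|·(4(d+1)n² + a) < (T − 2)^{−α}·n` then the
(1.9) clause of the typed `Ineq19_110` is violated at `μ`, `f = (−Δ^{η,N}_Ω + aP_k)1_{y_μ = n−1}`,
`x = (n−1)e_μ`, `x′ = (nT−2)e_μ`. [folklore] -/
theorem ineq19B_fails (hℓ : 1 ≤ ℓ) (hm2 : 0 ≤ m2plus) {a : ℝ} (ha : 0 < a) {Mb : ℕ} (hMb : 1 ≤ Mb)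
    (g : ∀ i : ZeroFieldInstance d, (↥i.R → ℝ) → ℝ) (k : ℕ) (hk : 1 ≤ k) {N : ℕ} (hN : 2 ≤ N)
    (hMN : 1 ≤ Mb * N) (e : ℝ) (μ : Fin (d + 1)) {α : ℝ} (hα : α < 0) {δ₀ : ℝ} (hδ : 0 ≤ δ₀) {c₀ : ℝ}
    (hc : |c₀| * (4 * ((d : ℝ) + 1) * (((ℓ + 1) ^ k : ℕ) : ℝ) ^ 2 + a) <
      (((Mb * N : ℕ) : ℝ) - 2) ^ (-α) * (((ℓ + 1) ^ k : ℕ) : ℝ)) (R₀ : ℝ) :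
    ¬ Ineq19_110 (boxFamB ℓ m2plus a Mb g (bigCube ℓ hm2 k hk Mb N hMN e)) α δ₀ c₀ R₀ := by
  intro h
  have hn : 2 ≤ (ℓ + 1) ^ k := two_le_Lk hℓ hk
  have hT : 2 ≤ Mb * N := two_le_MbN hMb hN
  have h1 := h.1 μ (src ((ℓ + 1) ^ k) (Mb * N) a μ) ⟨_, near_mem hn hT μ⟩ ⟨_, far_mem hn hT μ⟩
    (Or.inl (bigCube_rect hm2 a g k hk Mb N hMN e))
  have h2 : (((Mb * N : ℕ) : ℝ) - 2) ^ (-α) * (((ℓ + 1) ^ k : ℕ) : ℝ) ≤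
      (boxFamB ℓ m2plus a Mb g (bigCube ℓ hm2 k hk Mb N hMN e)).lhs19 α μ (src ((ℓ + 1) ^ k) (Mb * N) a μ)
        ⟨_, near_mem hn hT μ⟩ ⟨_, far_mem hn hT μ⟩ :=
    core_lhs_ge hn hT ha μ hα.le
  have hF0 : 0 ≤ 4 * ((d : ℝ) + 1) * (((ℓ + 1) ^ k : ℕ) : ℝ) ^ 2 + a := by positivity
  have hsup : (boxFamB ℓ m2plus a Mb g (bigCube ℓ hm2 k hk Mb N hMN e)).supNorm (src ((ℓ + 1) ^ k) (Mb * N) a μ) ≤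
      4 * ((d : ℝ) + 1) * (((ℓ + 1) ^ k : ℕ) : ℝ) ^ 2 + a :=
    supN_le_of_forall_le (i := (bigCube ℓ hm2 k hk Mb N hMN e).toZF) _ hF0 fun y => core_src_le hn hT ha μ y
  have hsup0 : 0 ≤ (boxFamB ℓ m2plus a Mb g (bigCube ℓ hm2 k hk Mb N hMN e)).supNorm (src ((ℓ + 1) ^ k) (Mb * N) a μ) :=
    supN_nonneg (bigCube ℓ hm2 k hk Mb N hMN e).toZF _
  have hs : 0 ≤ (boxFamB ℓ m2plus a Mb g (bigCube ℓ hm2 k hk Mb N hMN e)).sdist2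
      ⟨_, near_mem hn hT μ⟩ ⟨_, far_mem hn hT μ⟩ (src ((ℓ + 1) ^ k) (Mb * N) a μ) := setDist_edistR_nonneg _ _
  have h3 := rhs_le_abs (c₀ := c₀) hδ hs hsup0 hsup
  exact lt_irrefl _ (((h2.trans h1).trans h3).trans_lt hc)

/-- **THE SAME FAILURE IN node 12's BOND-CONVENTION CARRIER** (`boxFam`): both points of the witness carry genuine
bonds, where the two Hölder fields agree (`bond_lhs19_eq_of_bond`). [folklore] -/
theorem ineq19Bond_fails (hℓ : 1 ≤ ℓ) (hm2 : 0 ≤ m2plus) {a : ℝ} (ha : 0 < a) {Mb : ℕ} (hMb : 1 ≤ Mb)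
    (g : ∀ i : ZeroFieldInstance d, (↥i.R → ℝ) → ℝ) (k : ℕ) (hk : 1 ≤ k) {N : ℕ} (hN : 2 ≤ N)
    (hMN : 1 ≤ Mb * N) (e : ℝ) (μ : Fin (d + 1)) {α : ℝ} (hα : α < 0) {δ₀ : ℝ} (hδ : 0 ≤ δ₀) {c₀ : ℝ}
    (hc : |c₀| * (4 * ((d : ℝ) + 1) * (((ℓ + 1) ^ k : ℕ) : ℝ) ^ 2 + a) <
      (((Mb * N : ℕ) : ℝ) - 2) ^ (-α) * (((ℓ + 1) ^ k : ℕ) : ℝ)) (R₀ : ℝ) :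
    ¬ Ineq19_110 (boxFam ℓ m2plus a Mb g (bigCube ℓ hm2 k hk Mb N hMN e)) α δ₀ c₀ R₀ := by
  intro h
  have hn : 2 ≤ (ℓ + 1) ^ k := two_le_Lk hℓ hk
  have hT : 2 ≤ Mb * N := two_le_MbN hMb hN
  have h1 := h.1 μ (src ((ℓ + 1) ^ k) (Mb * N) a μ) ⟨_, near_mem hn hT μ⟩ ⟨_, far_mem hn hT μ⟩
    (Or.inl (BoxInst.rect a Mb g (bigCube ℓ hm2 k hk Mb N hMN e)))
  have e1 : (boxFam ℓ m2plus a Mb g (bigCube ℓ hm2 k hk Mb N hMN e)).lhs19 α μ (src ((ℓ + 1) ^ k) (Mb * N) a μ)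
        ⟨_, near_mem hn hT μ⟩ ⟨_, far_mem hn hT μ⟩ =
      (boxFamB ℓ m2plus a Mb g (bigCube ℓ hm2 k hk Mb N hMN e)).lhs19 α μ (src ((ℓ + 1) ^ k) (Mb * N) a μ)
        ⟨_, near_mem hn hT μ⟩ ⟨_, far_mem hn hT μ⟩ :=
    bond_lhs19_eq_of_bond a Mb g (bigCube ℓ hm2 k hk Mb N hMN e).toZF α _ (near_fwd_mem hn hT μ) (far_fwd_mem hn hT μ)
  rw [e1] at h1
  have h2 : (((Mb * N : ℕ) : ℝ) - 2) ^ (-α) * (((ℓ + 1) ^ k : ℕ) : ℝ) ≤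
      (boxFamB ℓ m2plus a Mb g (bigCube ℓ hm2 k hk Mb N hMN e)).lhs19 α μ (src ((ℓ + 1) ^ k) (Mb * N) a μ)
        ⟨_, near_mem hn hT μ⟩ ⟨_, far_mem hn hT μ⟩ :=
    core_lhs_ge hn hT ha μ hα.le
  have hF0 : 0 ≤ 4 * ((d : ℝ) + 1) * (((ℓ + 1) ^ k : ℕ) : ℝ) ^ 2 + a := by positivity
  have hsup : (boxFam ℓ m2plus a Mb g (bigCube ℓ hm2 k hk Mb N hMN e)).supNorm (src ((ℓ + 1) ^ k) (Mb * N) a μ) ≤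
      4 * ((d : ℝ) + 1) * (((ℓ + 1) ^ k : ℕ) : ℝ) ^ 2 + a :=
    supN_le_of_forall_le (i := (bigCube ℓ hm2 k hk Mb N hMN e).toZF) _ hF0 fun y => core_src_le hn hT ha μ y
  have hsup0 : 0 ≤ (boxFam ℓ m2plus a Mb g (bigCube ℓ hm2 k hk Mb N hMN e)).supNorm (src ((ℓ + 1) ^ k) (Mb * N) a μ) :=
    supN_nonneg (bigCube ℓ hm2 k hk Mb N hMN e).toZF _
  have hs : 0 ≤ (boxFam ℓ m2plus a Mb g (bigCube ℓ hm2 k hk Mb N hMN e)).sdist2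
      ⟨_, near_mem hn hT μ⟩ ⟨_, far_mem hn hT μ⟩ (src ((ℓ + 1) ^ k) (Mb * N) a μ) := setDist_edistR_nonneg _ _
  have h3 := rhs_le_abs (c₀ := c₀) hδ hs hsup0 hsup
  exact lt_irrefl _ (((h2.trans h1).trans h3).trans_lt hc)

/-! ### The size of the refuting cube: `N(d, n, a, c₀, α)` big blocks per side -/

/-- THE NUMBER OF BIG BLOCKS PER SIDE of the refuting cube: `N := ⌈(|c₀|(4(d+1)n² + a)/n + 1)^{1/(−α)}⌉ + 3`, so that
`(N − 2)^{−α} > |c₀|(4(d+1)n² + a)/n + 1` for `α < 0`. [folklore] -/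
noncomputable def negN (d n : ℕ) (a c₀ α : ℝ) : ℕ :=
  ⌈(|c₀| * (4 * ((d : ℝ) + 1) * (n : ℝ) ^ 2 + a) / n + 1) ^ (1 / (-α))⌉₊ + 3

/-- `N ≥ 3`. [folklore] -/
theorem three_le_negN (d n : ℕ) (a c₀ α : ℝ) : 3 ≤ negN d n a c₀ α := Nat.le_add_left 3 _

/-- **THE CHOICE OF `N` BEATS THE CONSTANT**: `|c₀|·(4(d+1)n² + a) < (Mb·N − 2)^{−α}·n` for `α < 0`, `n ≥ 1`,
`a > 0`, `Mb ≥ 1`. [folklore] -/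
theorem negN_spec (d : ℕ) {n : ℕ} (hn : 1 ≤ n) {a : ℝ} (ha : 0 < a) (c₀ : ℝ) {α : ℝ} (hα : α < 0) {Mb : ℕ}
    (hMb : 1 ≤ Mb) :
    |c₀| * (4 * ((d : ℝ) + 1) * (n : ℝ) ^ 2 + a) <
      (((Mb * negN d n a c₀ α : ℕ) : ℝ) - 2) ^ (-α) * (n : ℝ) := by
  have hn0 : (0 : ℝ) < n := by exact_mod_cast hn
  have hF0 : 0 < 4 * ((d : ℝ) + 1) * (n : ℝ) ^ 2 + a := by positivity
  have hC0 : 0 < |c₀| * (4 * ((d : ℝ) + 1) * (n : ℝ) ^ 2 + a) / n + 1 := by positivity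
  have hβ : 0 < -α := by linarith
  have hy0 : 0 ≤ (|c₀| * (4 * ((d : ℝ) + 1) * (n : ℝ) ^ 2 + a) / n + 1) ^ (1 / (-α)) :=
    Real.rpow_nonneg hC0.le _
  have hN2 : (|c₀| * (4 * ((d : ℝ) + 1) * (n : ℝ) ^ 2 + a) / n + 1) ^ (1 / (-α)) + 1 ≤
      ((negN d n a c₀ α : ℕ) : ℝ) - 2 := by
    unfold negN
    push_cast
    linarith [Nat.le_ceil ((|c₀| * (4 * ((d : ℝ) + 1) * (n : ℝ) ^ 2 + a) / n + 1) ^ (1 / (-α)))]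
  have hMbN : ((negN d n a c₀ α : ℕ) : ℝ) - 2 ≤ ((Mb * negN d n a c₀ α : ℕ) : ℝ) - 2 := by
    have h : negN d n a c₀ α ≤ Mb * negN d n a c₀ α := Nat.le_mul_of_pos_left _ hMb
    have h' : ((negN d n a c₀ α : ℕ) : ℝ) ≤ ((Mb * negN d n a c₀ α : ℕ) : ℝ) := by exact_mod_cast h
    linarith
  have h1 : |c₀| * (4 * ((d : ℝ) + 1) * (n : ℝ) ^ 2 + a) / n + 1 <
      (((Mb * negN d n a c₀ α : ℕ) : ℝ) - 2) ^ (-α) := by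
    calc |c₀| * (4 * ((d : ℝ) + 1) * (n : ℝ) ^ 2 + a) / n + 1
        = ((|c₀| * (4 * ((d : ℝ) + 1) * (n : ℝ) ^ 2 + a) / n + 1) ^ (1 / (-α))) ^ (-α) := by
          rw [← Real.rpow_mul hC0.le, one_div_mul_cancel hβ.ne', Real.rpow_one]
      _ < (((Mb * negN d n a c₀ α : ℕ) : ℝ) - 2) ^ (-α) := Real.rpow_lt_rpow hy0 (by linarith) hβ
  have h2 := mul_lt_mul_of_pos_right h1 hn0
  have h3 : (|c₀| * (4 * ((d : ℝ) + 1) * (n : ℝ) ^ 2 + a) / n + 1) * n =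
      |c₀| * (4 * ((d : ℝ) + 1) * (n : ℝ) ^ 2 + a) + n := by
    field_simp
  rw [h3] at h2
  linarith

/-- `1 ≤ Mb·N`. [folklore] -/
theorem one_le_Mb_negN {Mb : ℕ} (hMb : 1 ≤ Mb) (d n : ℕ) (a c₀ α : ℝ) : 1 ≤ Mb * negN d n a c₀ α :=
  le_trans hMb (Nat.le_mul_of_pos_right Mb (lt_of_lt_of_le (by norm_num) (three_le_negN d n a c₀ α)))

end Member

/-! ## §4 The kernel refutation of the literal Hölder range «α < 1» of the typed leaf on the box families -/

section Refutation

variable {ℓ : ℕ} {m2plus : ℝ}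

/-- **A MEMBER VIOLATING (1.9), FOR EVERY `α < 0` AND EVERY CHOICE OF CONSTANTS** (b04's verbatim carrier
`boxFamB`): given `α < 0`, `δ₀ ≥ 0`, `c₀`, `R₀`, `e₁`, the cube of `N(d, L, a, c₀, α)` big blocks per side at scale
`k = 1` with charge `e₁` meets the typed antecedents `regular`, `bigBlocks`, `e = e₁` and violates `Ineq19_110`.
[cite: Balaban1983RegularityDecay, Theorem p. 573 (1.9), case A = 0, Ω = Ω₀ a cube — the literal range «α < 1»
read with α < 0] -/
theorem exists_member_violating_B (hℓ : 1 ≤ ℓ) (hm2 : 0 ≤ m2plus) {a : ℝ} (ha : 0 < a) {Mb : ℕ} (hMb : 1 ≤ Mb)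
    (g : ∀ i : ZeroFieldInstance d, (↥i.R → ℝ) → ℝ) {α : ℝ} (hα : α < 0) {δ₀ : ℝ} (hδ : 0 ≤ δ₀)
    (c₀ R₀ e₁ : ℝ) :
    ∃ i : BoxInst d ℓ m2plus, (boxFamB ℓ m2plus a Mb g i).regular ∧ (boxFamB ℓ m2plus a Mb g i).bigBlocks ∧
      (boxFamB ℓ m2plus a Mb g i).e = e₁ ∧ ¬ Ineq19_110 (boxFamB ℓ m2plus a Mb g i) α δ₀ c₀ R₀ := by
  have hMN := one_le_Mb_negN hMb d ((ℓ + 1) ^ 1) a c₀ α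
  obtain ⟨hreg, hbig, hee⟩ := bigCube_hypotheses (ℓ := ℓ) hm2 a g 1 le_rfl hMb hMN e₁
  exact ⟨_, hreg, hbig, hee, ineq19B_fails hℓ hm2 ha hMb g 1 le_rfl
    (le_trans (by norm_num) (three_le_negN d _ a c₀ α)) hMN e₁ 0 hα hδ
    (negN_spec d (BoxInst.one_le_Lk ℓ 1) ha c₀ hα hMb) R₀⟩

/-- the same in node 12's bond-convention carrier `boxFam`. [folklore] -/
theorem exists_member_violating_bond (hℓ : 1 ≤ ℓ) (hm2 : 0 ≤ m2plus) {a : ℝ} (ha : 0 < a) {Mb : ℕ}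
    (hMb : 1 ≤ Mb) (g : ∀ i : ZeroFieldInstance d, (↥i.R → ℝ) → ℝ) {α : ℝ} (hα : α < 0) {δ₀ : ℝ} (hδ : 0 ≤ δ₀)
    (c₀ R₀ e₁ : ℝ) :
    ∃ i : BoxInst d ℓ m2plus, (boxFam ℓ m2plus a Mb g i).regular ∧ (boxFam ℓ m2plus a Mb g i).bigBlocks ∧
      (boxFam ℓ m2plus a Mb g i).e = e₁ ∧ ¬ Ineq19_110 (boxFam ℓ m2plus a Mb g i) α δ₀ c₀ R₀ := by
  have hMN := one_le_Mb_negN hMb d ((ℓ + 1) ^ 1) a c₀ α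
  obtain ⟨hreg, hbig, hee⟩ := bigCube_hypotheses_bond (ℓ := ℓ) hm2 a g 1 le_rfl hMb hMN e₁
  exact ⟨_, hreg, hbig, hee, ineq19Bond_fails hℓ hm2 ha hMb g 1 le_rfl
    (le_trans (by norm_num) (three_le_negN d _ a c₀ α)) hMN e₁ 0 hα hδ
    (negN_spec d (BoxInst.one_le_Lk ℓ 1) ha c₀ hα hMb) R₀⟩

/-- **NO CONSTANTS AT ALL FOR `α < 0`**: the `α`-clause of the typed leaf `B4.ThmPrinted` (∃ positive δ₀ c₀ R₀ e₁ with
(1.9)–(1.12) for every member meeting the antecedents) fails on `boxFamB` for every `α < 0`. [folklore] -/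
theorem leafClause_fails_B (hℓ : 1 ≤ ℓ) (hm2 : 0 ≤ m2plus) {a : ℝ} (ha : 0 < a) {Mb : ℕ} (hMb : 1 ≤ Mb)
    (g : ∀ i : ZeroFieldInstance d, (↥i.R → ℝ) → ℝ) {α : ℝ} (hα : α < 0) :
    ¬ ∃ δ₀ c₀ R₀ e₁ : ℝ, 0 < δ₀ ∧ 0 < c₀ ∧ 0 < R₀ ∧ 0 < e₁ ∧ ∀ i : BoxInst d ℓ m2plus,
      (boxFamB ℓ m2plus a Mb g i).regular → (boxFamB ℓ m2plus a Mb g i).bigBlocks →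
        0 < (boxFamB ℓ m2plus a Mb g i).e → (boxFamB ℓ m2plus a Mb g i).e ≤ e₁ →
          Ineq19_110 (boxFamB ℓ m2plus a Mb g i) α δ₀ c₀ R₀ ∧
            Ineq111_112 (boxFamB ℓ m2plus a Mb g i) α δ₀ c₀ R₀ := by
  rintro ⟨δ₀, c₀, R₀, e₁, hδ, _, _, he, H⟩
  obtain ⟨i, hreg, hbig, hee, hnot⟩ := exists_member_violating_B hℓ hm2 ha hMb g hα hδ.le c₀ R₀ e₁
  exact hnot (H i hreg hbig (hee ▸ he) hee.le).1

/-- the same for `boxFam`. [folklore] -/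
theorem leafClause_fails_bond (hℓ : 1 ≤ ℓ) (hm2 : 0 ≤ m2plus) {a : ℝ} (ha : 0 < a) {Mb : ℕ} (hMb : 1 ≤ Mb)
    (g : ∀ i : ZeroFieldInstance d, (↥i.R → ℝ) → ℝ) {α : ℝ} (hα : α < 0) :
    ¬ ∃ δ₀ c₀ R₀ e₁ : ℝ, 0 < δ₀ ∧ 0 < c₀ ∧ 0 < R₀ ∧ 0 < e₁ ∧ ∀ i : BoxInst d ℓ m2plus,
      (boxFam ℓ m2plus a Mb g i).regular → (boxFam ℓ m2plus a Mb g i).bigBlocks →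
        0 < (boxFam ℓ m2plus a Mb g i).e → (boxFam ℓ m2plus a Mb g i).e ≤ e₁ →
          Ineq19_110 (boxFam ℓ m2plus a Mb g i) α δ₀ c₀ R₀ ∧
            Ineq111_112 (boxFam ℓ m2plus a Mb g i) α δ₀ c₀ R₀ := by
  rintro ⟨δ₀, c₀, R₀, e₁, hδ, _, _, he, H⟩
  obtain ⟨i, hreg, hbig, hee, hnot⟩ := exists_member_violating_bond hℓ hm2 ha hMb g hα hδ.le c₀ R₀ e₁
  exact hnot (H i hreg hbig (hee ▸ he) hee.le).1

/-- **THE TYPED LEAF `B4.ThmPrinted` IS FALSE ON b04's VERBATIM ZERO-FIELD CARRIER OVER THE BOX FAMILY** (every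
`L ≥ 2`, `a > 0`, mass window `[0, m²₊]`, big-block size `Mb ≥ 1`, boundary assignment `g`): its literal Hölder
range «∀ α < 1» includes `α = −1`. [cite: Balaban1983RegularityDecay, Theorem p. 573, case A = 0 — kernel
refutation of the literal range «α < 1» of the typed transcription; the print's Hölder range is 0 ≤ α < 1] -/
theorem not_thmPrinted_boxFamB (hℓ : 1 ≤ ℓ) (hm2 : 0 ≤ m2plus) {a : ℝ} (ha : 0 < a) {Mb : ℕ} (hMb : 1 ≤ Mb)
    (g : ∀ i : ZeroFieldInstance d, (↥i.R → ℝ) → ℝ) : ¬ ThmPrinted (boxFamB ℓ m2plus a Mb g) :=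
  fun H => leafClause_fails_B hℓ hm2 ha hMb g (by norm_num : (-1 : ℝ) < 0) (H (-1) (by norm_num))

/-- **… AND ON node 12's BOND-CONVENTION CARRIER `boxFam`.** [cite: Balaban1983RegularityDecay, Theorem p. 573,
case A = 0 — kernel refutation of the literal range «α < 1» of the typed transcription] -/
theorem not_thmPrinted_boxFam (hℓ : 1 ≤ ℓ) (hm2 : 0 ≤ m2plus) {a : ℝ} (ha : 0 < a) {Mb : ℕ} (hMb : 1 ≤ Mb)
    (g : ∀ i : ZeroFieldInstance d, (↥i.R → ℝ) → ℝ) : ¬ ThmPrinted (boxFam ℓ m2plus a Mb g) :=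
  fun H => leafClause_fails_bond hℓ hm2 ha hMb g (by norm_num : (-1 : ℝ) < 0) (H (-1) (by norm_num))

/-- **… AND ON b04's DEFAULT CARRIER `zeroFieldSetting a Mb` READ ON THE BOX INSTANCES** (no field re-read).
[folklore] -/
theorem not_thmPrinted_zeroFieldSetting_box (hℓ : 1 ≤ ℓ) (hm2 : 0 ≤ m2plus) {a : ℝ} (ha : 0 < a) {Mb : ℕ}
    (hMb : 1 ≤ Mb) : ¬ ThmPrinted (fun i : BoxInst d ℓ m2plus => zeroFieldSetting a Mb i.toZF) :=
  not_thmPrinted_boxFamB hℓ hm2 ha hMb _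

/-- **… AND OVER b04's OWN INDEX TYPE**: the typed leaf fails for the carrier `zeroFieldSettingB a Mb g` on ALL
zero-field instances (`B4Cor23ZeroEta.ZeroFieldInstance d`) — the refuting member is the image `i.toZF` of the cube
above (`L = 2`, `k = 1`, `m² = 0 ∈ [0, 0]`). [cite: Balaban1983RegularityDecay, Theorem p. 573, case A = 0 — kernel
refutation of the literal range «α < 1» of the typed transcription] -/
theorem not_thmPrinted_zeroFieldSettingB {a : ℝ} (ha : 0 < a) {Mb : ℕ} (hMb : 1 ≤ Mb)
    (g : ∀ i : ZeroFieldInstance d, (↥i.R → ℝ) → ℝ) :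
    ¬ ThmPrinted (zeroFieldSettingB a Mb g : ZeroFieldInstance d → EtaSetting) := by
  intro H
  obtain ⟨δ₀, c₀, R₀, e₁, hδ, _, _, he, H1⟩ := H (-1) (by norm_num)
  obtain ⟨i, hreg, hbig, hee, hnot⟩ :=
    exists_member_violating_B (d := d) (ℓ := 1) (m2plus := 0) le_rfl le_rfl ha hMb g
      (by norm_num : (-1 : ℝ) < 0) hδ.le c₀ R₀ e₁
  exact hnot (H1 i.toZF hreg hbig (hee ▸ he) hee.le).1

/-- **… IN PARTICULAR FOR b04's DEFAULT CARRIER `zeroFieldSetting a Mb`** (`B4Cor23ZeroEta`), every `a > 0`,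
`Mb ≥ 1`. [cite: Balaban1983RegularityDecay, Theorem p. 573, case A = 0 — kernel refutation of the literal range
«α < 1» of the typed transcription] -/
theorem not_thmPrinted_zeroFieldSetting {a : ℝ} (ha : 0 < a) {Mb : ℕ} (hMb : 1 ≤ Mb) :
    ¬ ThmPrinted (zeroFieldSetting a Mb : ZeroFieldInstance d → EtaSetting) :=
  not_thmPrinted_zeroFieldSettingB ha hMb _

/-- and for node 12's bond-convention carrier over all zero-field instances. [folklore] -/
theorem not_thmPrinted_zeroFieldSettingBond {a : ℝ} (ha : 0 < a) {Mb : ℕ} (hMb : 1 ≤ Mb)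
    (g : ∀ i : ZeroFieldInstance d, (↥i.R → ℝ) → ℝ) :
    ¬ ThmPrinted (zeroFieldSettingBond a Mb g : ZeroFieldInstance d → EtaSetting) := by
  intro H
  obtain ⟨δ₀, c₀, R₀, e₁, hδ, _, _, he, H1⟩ := H (-1) (by norm_num)
  obtain ⟨i, hreg, hbig, hee, hnot⟩ :=
    exists_member_violating_bond (d := d) (ℓ := 1) (m2plus := 0) le_rfl le_rfl ha hMb g
      (by norm_num : (-1 : ℝ) < 0) hδ.le c₀ R₀ e₁
  exact hnot (H1 i.toZF hreg hbig (hee ▸ he) hee.le).1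

/-! ### The Hölder-range dichotomy: `0 ≤ α < 1` holds (nodes 12, 14), «α < 1» verbatim fails (this file) -/

/-- **THE HÖLDER-RANGE DICHOTOMY ON b04's VERBATIM CARRIER**: on the zero-field box family the typed (1.9)–(1.10)
leaf half HOLDS for the Hölder range `0 ≤ α < 1` (`B4Ineq19ZeroBoxFace.thmPrinted19NN_boxFamB`) while the typed
leaf with its literal range «α < 1» FAILS. [cite: Balaban1983RegularityDecay, Theorem p. 573 (1.9)–(1.10), case
A = 0, Ω a box] -/
theorem holderRange_dichotomy_B (hℓ : 1 ≤ ℓ) (hm2 : 0 ≤ m2plus) {a : ℝ} (ha : 0 < a) {Mb : ℕ} (hMb : 1 ≤ Mb)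
    (g : ∀ i : ZeroFieldInstance d, (↥i.R → ℝ) → ℝ) :
    ThmPrinted19NN (boxFamB ℓ m2plus a Mb g) ∧ ¬ ThmPrinted (boxFamB ℓ m2plus a Mb g) :=
  ⟨thmPrinted19NN_boxFamB hℓ a ha Mb g, not_thmPrinted_boxFamB hℓ hm2 ha hMb g⟩

/-- the same dichotomy on node 12's bond-convention carrier (`B4Ineq19ZeroBoxEta.thmPrinted19NN_boxFam`).
[cite: Balaban1983RegularityDecay, Theorem p. 573 (1.9)–(1.10), case A = 0, Ω a box] -/
theorem holderRange_dichotomy_bond (hℓ : 1 ≤ ℓ) (hm2 : 0 ≤ m2plus) {a : ℝ} (ha : 0 < a) {Mb : ℕ}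
    (hMb : 1 ≤ Mb) (g : ∀ i : ZeroFieldInstance d, (↥i.R → ℝ) → ℝ) :
    ThmPrinted19NN (boxFam ℓ m2plus a Mb g) ∧ ¬ ThmPrinted (boxFam ℓ m2plus a Mb g) :=
  ⟨thmPrinted19NN_boxFam hℓ a ha Mb g, not_thmPrinted_boxFam hℓ hm2 ha hMb g⟩

/-- the same dichotomy on b04's default carrier read on the box instances
(`B4Ineq19ZeroBoxFace.thmPrinted19NN_zeroFieldSetting`). [cite: Balaban1983RegularityDecay, Theorem p. 573
(1.9)–(1.10), case A = 0, Ω a box] -/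
theorem holderRange_dichotomy_std (hℓ : 1 ≤ ℓ) (hm2 : 0 ≤ m2plus) {a : ℝ} (ha : 0 < a) {Mb : ℕ}
    (hMb : 1 ≤ Mb) :
    ThmPrinted19NN (fun i : BoxInst d ℓ m2plus => zeroFieldSetting a Mb i.toZF) ∧
      ¬ ThmPrinted (fun i : BoxInst d ℓ m2plus => zeroFieldSetting a Mb i.toZF) :=
  ⟨thmPrinted19NN_zeroFieldSetting hℓ a ha Mb, not_thmPrinted_zeroFieldSetting_box hℓ hm2 ha hMb⟩

/-- hence the typed leaf is STRICTLY stronger than its `0 ≤ α` half on these families: `ThmPrinted19NN` does not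
imply `ThmPrinted` (the converse of `B4Ineq19ZeroBoxEta.thmPrinted19NN_of_thmPrinted` fails). [folklore] -/
theorem not_thmPrinted_of_thmPrinted19NN (hℓ : 1 ≤ ℓ) (hm2 : 0 ≤ m2plus) {a : ℝ} (ha : 0 < a) {Mb : ℕ}
    (hMb : 1 ≤ Mb) (g : ∀ i : ZeroFieldInstance d, (↥i.R → ℝ) → ℝ) :
    ¬ (ThmPrinted19NN (boxFamB ℓ m2plus a Mb g) → ThmPrinted (boxFamB ℓ m2plus a Mb g)) :=
  fun h => not_thmPrinted_boxFamB hℓ hm2 ha hMb g (h (thmPrinted19NN_boxFamB hℓ a ha Mb g))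

end Refutation

/-! ## §5 Non-vacuity: the physical instance `d + 1 = 4`, `L = 2`, `a = 1`, unit big blocks -/

section NonVacuity

/-- the refutation is inhabited: in dimension `d + 1 = 4` with `L = 2`, `a = 1`, mass window `{0}`, `Mb = 1` and the
zero boundary assignment, the typed leaf fails on b04's verbatim carrier over the box family … [folklore] -/
example : ¬ ThmPrinted (boxFamB (d := 3) 1 0 1 1 fun _ _ => 0) :=
  not_thmPrinted_boxFamB le_rfl le_rfl one_pos le_rfl _

/-- … while its `0 ≤ α < 1` half holds there, … [folklore] -/
example : ThmPrinted19NN (boxFamB (d := 3) 1 0 1 1 fun _ _ => 0) ∧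
    ¬ ThmPrinted (boxFamB (d := 3) 1 0 1 1 fun _ _ => 0) :=
  holderRange_dichotomy_B le_rfl le_rfl one_pos le_rfl _

/-- … and b04's default carrier over ALL four-dimensional zero-field instances fails the typed leaf. [folklore] -/
example : ¬ ThmPrinted (zeroFieldSetting 1 1 : ZeroFieldInstance 3 → EtaSetting) :=
  not_thmPrinted_zeroFieldSetting one_pos le_rfl

end NonVacuity

end Literature.MathematicalPhysics.QuantumFieldTheory.Balaban1983to89.B4Thm19ZeroBoxNegAlpha
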